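import Mathlib.Algebra.Lie.UniversalEnveloping
import Mathlib.Algebra.Lie.OfAssociative
import Mathlib.Algebra.FreeMonoid.Basic
import Mathlib.Analysis.RCLike.Basic
import Mathlib.Data.Matrix.Basis
import Literature.Algebra.Lie.PoincareBirkhoffWitt
import HarnessLib

/-!
# Triangular spanning of `U(𝔤𝔩ₙ(𝕜))` (the easy half of Poincaré–Birkhoff–Witt)

Trunk: AutomorphicL (support for `Literature.NumberTheory.Automorphic.HarishChandraGL`, the proof of
`Literature.NumberTheory.Automorphic.nonempty_harishChandraHomGL`).

Let `𝕜` be `ℝ` or `ℂ` (`[RCLike 𝕜]`) and `𝔤 = 𝔤𝔩ₙ(𝕜) = Matrix (Fin n) (Fin n) 𝕜`, a real Lie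
algebra for the commutator bracket, with real universal enveloping algebra
`U(𝔤) = UniversalEnvelopingAlgebra ℝ 𝔤` and canonical map `ι : 𝔤 → U(𝔤)`.
Write `𝔤 = 𝔫⁻ ⊕ 𝔥 ⊕ 𝔫` (strictly lower triangular, diagonal, strictly upper triangular matrices).
As a real vector space `𝔤` is spanned by the *letters* `b • E_{jk} = Matrix.single j k b`
(`b : 𝕜`), which are lower (`k < j`), diagonal (`j = k`) or upper (`j < k`).

The main result `span_triangularWords_eq_top` is the spanning half of the
Poincaré–Birkhoff–Witt theorem in its triangular form
`U(𝔤) = U(𝔫⁻) · U(𝔥) · U(𝔫)`: the real span of the *standard monomials*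
`ι(Y₁)⋯ι(Y_a) · ι(H₁)⋯ι(H_b) · ι(X₁)⋯ι(X_c)` (`Yᵢ` lower, `Hᵢ` diagonal, `Xᵢ` upper letters) is all
of `U(𝔤)`. This is the input to the construction of the Harish-Chandra homomorphism
(Knapp, *Lie Groups Beyond an Introduction*, §V.5, proof of Lemma 5.42 ff.; Humphreys,
*Introduction to Lie Algebras and Representation Theory*, §17.3 Corollary C and §23.3, where the
PBW basis "putting the `y_α` first, then the `hᵢ`, then the `x_α`" is used). The proof is the
usual induction: moving a letter leftwards past a lower letter costs a commutator, which is again a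
sum of at most two letters.

Relation to the full Poincaré–Birkhoff–Witt theorem of the tree. `Literature.Algebra.Lie.
PoincareBirkhoffWitt` proves PBW in full for any Lie algebra with an ordered basis over any
commutative ring (`Literature.Algebra.Lie.PBW.pbwBasis`, with the two halves `Literature.Algebra.Lie.PBW.span_ordMonomial_eq_top` and
`Literature.Algebra.Lie.PBW.linearIndependent_ordMonomial`); its relation `Literature.Algebra.Lie.PBW.ι_mul_ι` is used below. The present
file nevertheless keeps a direct proof of the *triangular spanning statement* in the precise form
consumed by `HarishChandraGLProjection`: expansions `u = ∑ᵢ cᵢ • Yᵢ Hᵢ Xᵢ` whose three sub-words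
`Yᵢ`, `Hᵢ`, `Xᵢ` are separate `FreeMonoid` data over *all* letters `b • E_{jk}`, `b : 𝕜` (not over a
fixed ordered `ℝ`-basis of `𝔤𝔩ₙ(𝕜)`), from which the `𝔥`-component `∑_{Yᵢ = Xᵢ = 1} cᵢ Hᵢ` is read
off.
Deriving this form from `pbwBasis` would require an ordered real basis of `𝕜 ⊗ {E_{jk}}` listed
lower < diagonal < upper and the splitting of sorted index lists along a lexicographic sum order —
glue of the same size as the direct induction below (about 150 lines). The *independence* half of
PBW is not used anywhere downstream: the Harish-Chandra polynomial is computed from a *chosen*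
expansion, and its independence of that choice (together with multiplicativity and `W`-symmetry)
is obtained in `HarishChandraGLExistence` from its values on highest weight vectors of every weight.

## Main definitions

* `Literature.NumberTheory.Automorphic.HCSpan.lowerWord`, `diagWord`, `upperWord` — the monoid maps from the free
  monoids of lower / diagonal / upper letters to `U(𝔤)` (products of `ι`'s).
* `Literature.Automorphic.HCSpan.triangularWords 𝕜 n` — the set of standard monomials
  `lowerWord w₁ * diagWord w₂ * upperWord w₃`.

## Main statements

* `Literature.NumberTheory.Automorphic.HCSpan.span_triangularWords_eq_top` — the standard monomials span `U(𝔤)`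
  over `ℝ`.
* `Literature.NumberTheory.Automorphic.HCSpan.exists_sum_triangularWords` — every `u ∈ U(𝔤)` is a finite real linear
  combination of standard monomials (unpacked form).
* `Literature.NumberTheory.Automorphic.HCSpan.mul_mem_of_ι_mul_mem` — a real subspace of `U(𝔤)` stable under left
  multiplication by `ι(𝔤)` is stable under left multiplication by `U(𝔤)`.

## Design notes

* Words are elements of free monoids (`FreeMonoid`) on the letter index types, so that data attached
  to a word (its length, its `ad`-weight, the polynomial it defines on `𝔥^*`) is available by
  `FreeMonoid.lift`; no linear independence is claimed or needed here (it is available in the tree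
  as `Literature.Algebra.Lie.PBW.linearIndependent_ordMonomial`, see above).
* The Lie bracket on matrices and on `U(𝔤)` is the commutator via Mathlib's idiom
  `attribute [local instance 100] LieRing.ofAssociativeRing`, as in `HarishChandraGL`.

## References

* `Literature.Algebra.Lie.PoincareBirkhoffWitt` (this tree) — the full PBW theorem.
* A. W. Knapp, *Lie Groups Beyond an Introduction*, 2nd ed., Birkhäuser 2002, Ch. III (PBW), §V.5.
* J. E. Humphreys, *Introduction to Lie Algebras and Representation Theory*, GTM 9, Springer 1972,
  §17.3 (PBW theorem, Corollary C), §23.3.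
-/

attribute [local instance 100] LieRing.ofAssociativeRing

open scoped Matrix

noncomputable section

namespace Literature.NumberTheory.Automorphic.HCSpan

variable (𝕜 : Type*) [RCLike 𝕜] (n : ℕ)

/-- Index type of the *lower letters* `b • E_{jk}`, `k < j` (spanning `𝔫⁻`). [folklore] -/
abbrev LowerLetter : Type _ := {p : Fin n × Fin n // p.2 < p.1} × 𝕜

/-- Index type of the *diagonal letters* `b • E_{jj}` (spanning `𝔥`). [folklore] -/
abbrev DiagLetter : Type _ := Fin n × 𝕜

/-- Index type of the *upper letters* `b • E_{jk}`, `j < k` (spanning `𝔫`). [folklore] -/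
abbrev UpperLetter : Type _ := {p : Fin n × Fin n // p.1 < p.2} × 𝕜

/-- Shorthand for the real universal enveloping algebra `U(𝔤𝔩ₙ(𝕜))`. [folklore] -/
abbrev UGL : Type _ := UniversalEnvelopingAlgebra ℝ (Matrix (Fin n) (Fin n) 𝕜)

variable {𝕜 n}

/-- The canonical map `ι : 𝔤𝔩ₙ(𝕜) → U(𝔤𝔩ₙ(𝕜))` (abbreviation). [folklore] -/
abbrev ιU : Matrix (Fin n) (Fin n) 𝕜 →ₗ⁅ℝ⁆ UGL 𝕜 n := UniversalEnvelopingAlgebra.ι ℝ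

variable (𝕜 n)

/-- The word map on lower letters: `w ↦ ∏_{(j,k,b) ∈ w} ι(b E_{jk})`. [folklore] -/
def lowerWord : FreeMonoid (LowerLetter 𝕜 n) →* UGL 𝕜 n :=
  FreeMonoid.lift fun ℓ ↦ ιU (Matrix.single ℓ.1.1.1 ℓ.1.1.2 ℓ.2)

/-- The word map on diagonal letters: `w ↦ ∏_{(j,b) ∈ w} ι(b E_{jj})`. [folklore] -/
def diagWord : FreeMonoid (DiagLetter 𝕜 n) →* UGL 𝕜 n :=
  FreeMonoid.lift fun ℓ ↦ ιU (Matrix.single ℓ.1 ℓ.1 ℓ.2)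

/-- The word map on upper letters: `w ↦ ∏_{(j,k,b) ∈ w} ι(b E_{jk})`. [folklore] -/
def upperWord : FreeMonoid (UpperLetter 𝕜 n) →* UGL 𝕜 n :=
  FreeMonoid.lift fun ℓ ↦ ιU (Matrix.single ℓ.1.1.1 ℓ.1.1.2 ℓ.2)

/-- The *standard (triangular) monomials* `Y-word · H-word · X-word` in `U(𝔤𝔩ₙ(𝕜))`.
Knapp, Ch. III and §V.5; Humphreys, §17.3 and §23.3. [folklore] -/
def triangularWords : Set (UGL 𝕜 n) :=
  {u | ∃ (w₁ : FreeMonoid (LowerLetter 𝕜 n)) (w₂ : FreeMonoid (DiagLetter 𝕜 n))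
    (w₃ : FreeMonoid (UpperLetter 𝕜 n)), u = lowerWord 𝕜 n w₁ * diagWord 𝕜 n w₂ * upperWord 𝕜 n w₃}

/-- The real span of the standard monomials. [folklore] -/
abbrev triangularSpan : Submodule ℝ (UGL 𝕜 n) := Submodule.span ℝ (triangularWords 𝕜 n)

variable {𝕜 n}

/-- `lowerWord` on a single letter. [folklore] -/
@[simp] theorem lowerWord_of (ℓ : LowerLetter 𝕜 n) :
    lowerWord 𝕜 n (FreeMonoid.of ℓ) = ιU (Matrix.single ℓ.1.1.1 ℓ.1.1.2 ℓ.2) := rfl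

/-- `diagWord` on a single letter. [folklore] -/
@[simp] theorem diagWord_of (ℓ : DiagLetter 𝕜 n) :
    diagWord 𝕜 n (FreeMonoid.of ℓ) = ιU (Matrix.single ℓ.1 ℓ.1 ℓ.2) := rfl

/-- `upperWord` on a single letter. [folklore] -/
@[simp] theorem upperWord_of (ℓ : UpperLetter 𝕜 n) :
    upperWord 𝕜 n (FreeMonoid.of ℓ) = ιU (Matrix.single ℓ.1.1.1 ℓ.1.1.2 ℓ.2) := rfl

/-- Standard monomials lie in their span. [folklore] -/
theorem word_mem (w₁ : FreeMonoid (LowerLetter 𝕜 n)) (w₂ : FreeMonoid (DiagLetter 𝕜 n))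
    (w₃ : FreeMonoid (UpperLetter 𝕜 n)) :
    lowerWord 𝕜 n w₁ * diagWord 𝕜 n w₂ * upperWord 𝕜 n w₃ ∈ triangularSpan 𝕜 n :=
  Submodule.subset_span ⟨w₁, w₂, w₃, rfl⟩

/-- `1` is the empty standard monomial. [folklore] -/
theorem one_mem_triangularWords : (1 : UGL 𝕜 n) ∈ triangularWords 𝕜 n :=
  ⟨1, 1, 1, by simp⟩

/-- Left multiplication by `u` preserves a span as soon as it maps the generators into it.
[folklore] -/
theorem mul_mem_span_of_forall {u : UGL 𝕜 n} {S : Set (UGL 𝕜 n)}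
    (h : ∀ s ∈ S, u * s ∈ Submodule.span ℝ S) {a : UGL 𝕜 n} (ha : a ∈ Submodule.span ℝ S) :
    u * a ∈ Submodule.span ℝ S := by
  induction ha using Submodule.span_induction with
  | mem s hs => exact h s hs
  | zero => simp
  | add x y _ _ hx hy => rw [mul_add]; exact add_mem hx hy
  | smul r x _ hx => rw [mul_smul_comm]; exact Submodule.smul_mem _ r hx

/-- The commutator of two letters: `[b E_{jk}, c E_{pq}] = δ_{kp} (bc) E_{jq} - δ_{qj} (cb) E_{pk}`.
[folklore] -/
theorem single_lie_single (j k p q : Fin n) (b c : 𝕜) :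
    ⁅Matrix.single j k b, Matrix.single p q c⁆ =
      Matrix.single j q (if k = p then b * c else 0) -
        Matrix.single p k (if q = j then c * b else 0) := by
  rw [Ring.lie_def]
  congr 1
  · split_ifs with h
    · subst h; exact Matrix.single_mul_single_same b j k q c
    · rw [Matrix.single_zero]; exact Matrix.single_mul_single_of_ne b j k p h c
  · split_ifs with h
    · subst h; exact Matrix.single_mul_single_same c p q k b
    · rw [Matrix.single_zero]; exact Matrix.single_mul_single_of_ne c p q j h b

/-- Commuting a letter past the first letter of a product, inside `U(𝔤)`
(from `Literature.PBW.ι_mul_ι : ι a * ι b = ι b * ι a + ι ⁅a, b⁆`). [folklore] -/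
theorem ι_mul_ι_mul (a b : Matrix (Fin n) (Fin n) 𝕜) (R : UGL 𝕜 n) :
    (ιU a : UGL 𝕜 n) * (ιU b * R) = ιU b * (ιU a * R) + ιU ⁅a, b⁆ * R := by
  rw [← mul_assoc, Literature.Algebra.Lie.PBW.ι_mul_ι, add_mul, mul_assoc]

/-- A letter with coefficient `if P then e else 0` acts into the span if it does so when `P` holds.
[folklore] -/
theorem single_ite_mul_mem {P : Prop} [Decidable P] {a a' : Fin n} {e : 𝕜} {R : UGL 𝕜 n}
    (h : P → ιU (Matrix.single a a' e) * R ∈ triangularSpan 𝕜 n) :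
    ιU (Matrix.single a a' (if P then e else 0)) * R ∈ triangularSpan 𝕜 n := by
  split_ifs with hP
  · exact h hP
  · simp

/-! ### Stability of the span under left multiplication by letters -/

/-- Lower letters: `ι(Y) · (element of the span)` stays in the span, since `ι(Y)` times a standard
monomial is a standard monomial. [folklore] -/
theorem lower_mul_mem {j k : Fin n} (hkj : k < j) (b : 𝕜) {a : UGL 𝕜 n}
    (ha : a ∈ triangularSpan 𝕜 n) : ιU (Matrix.single j k b) * a ∈ triangularSpan 𝕜 n := by
  refine mul_mem_span_of_forall (fun s hs ↦ ?_) ha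
  obtain ⟨w₁, w₂, w₃, rfl⟩ := hs
  have : ιU (Matrix.single j k b) * (lowerWord 𝕜 n w₁ * diagWord 𝕜 n w₂ * upperWord 𝕜 n w₃) =
      lowerWord 𝕜 n (FreeMonoid.of (⟨⟨(j, k), hkj⟩, b⟩ : LowerLetter 𝕜 n) * w₁) *
        diagWord 𝕜 n w₂ * upperWord 𝕜 n w₃ := by
    simp only [map_mul, lowerWord_of, mul_assoc]
  rw [this]
  exact word_mem _ _ _

/-- Diagonal letters: `ι(H) · (standard monomial) ∈ span`, by induction on the lower word,
using `[H, Y] ∈ 𝔫⁻` (a lower letter). [folklore] -/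
theorem diag_mul_word_mem (j : Fin n) (b : 𝕜)
    (w₁ : FreeMonoid (LowerLetter 𝕜 n)) (w₂ : FreeMonoid (DiagLetter 𝕜 n))
    (w₃ : FreeMonoid (UpperLetter 𝕜 n)) :
    ιU (Matrix.single j j b) * (lowerWord 𝕜 n w₁ * diagWord 𝕜 n w₂ * upperWord 𝕜 n w₃) ∈
      triangularSpan 𝕜 n := by
  induction w₁ using FreeMonoid.inductionOn' generalizing b with
  | one =>
    have : ιU (Matrix.single j j b) * (lowerWord 𝕜 n 1 * diagWord 𝕜 n w₂ * upperWord 𝕜 n w₃) =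
        lowerWord 𝕜 n 1 * diagWord 𝕜 n (FreeMonoid.of (j, b) * w₂) * upperWord 𝕜 n w₃ := by
      simp only [map_one, one_mul, map_mul, diagWord_of, mul_assoc]
    rw [this]; exact word_mem _ _ _
  | mul_of ℓ w ih =>
    obtain ⟨⟨⟨p, q⟩, hqp⟩, c⟩ := ℓ
    have hR : lowerWord 𝕜 n (FreeMonoid.of (⟨⟨(p, q), hqp⟩, c⟩ : LowerLetter 𝕜 n) * w) *
        diagWord 𝕜 n w₂ * upperWord 𝕜 n w₃ = ιU (Matrix.single p q c) *
        (lowerWord 𝕜 n w * diagWord 𝕜 n w₂ * upperWord 𝕜 n w₃) := by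
      simp only [map_mul, lowerWord_of, mul_assoc]
    rw [hR, ι_mul_ι_mul]
    refine add_mem (lower_mul_mem hqp c (ih b)) ?_
    rw [single_lie_single, map_sub, sub_mul]
    refine sub_mem (single_ite_mul_mem fun h ↦ ?_) (single_ite_mul_mem fun h ↦ ?_)
    · subst h; exact lower_mul_mem hqp _ (word_mem _ _ _)
    · subst h; exact lower_mul_mem hqp _ (word_mem _ _ _)

/-- Diagonal letters preserve the span. [folklore] -/
theorem diag_mul_mem (j : Fin n) (b : 𝕜) {a : UGL 𝕜 n} (ha : a ∈ triangularSpan 𝕜 n) :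
    ιU (Matrix.single j j b) * a ∈ triangularSpan 𝕜 n := by
  refine mul_mem_span_of_forall (fun s hs ↦ ?_) ha
  obtain ⟨w₁, w₂, w₃, rfl⟩ := hs
  exact diag_mul_word_mem j b w₁ w₂ w₃

/-- Trichotomy step: an arbitrary matrix unit times a standard monomial with lower word `w` lies in
the span, provided all *upper* letters send the standard monomials with lower word `w` into the
span. [folklore] -/
theorem single_mul_word_mem_of_upper (w : FreeMonoid (LowerLetter 𝕜 n))
    (hup : ∀ (j k : Fin n), j < k → ∀ (b : 𝕜) (w₂ : FreeMonoid (DiagLetter 𝕜 n))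
      (w₃ : FreeMonoid (UpperLetter 𝕜 n)),
      ιU (Matrix.single j k b) * (lowerWord 𝕜 n w * diagWord 𝕜 n w₂ * upperWord 𝕜 n w₃) ∈
        triangularSpan 𝕜 n)
    (a a' : Fin n) (e : 𝕜) (w₂ : FreeMonoid (DiagLetter 𝕜 n))
    (w₃ : FreeMonoid (UpperLetter 𝕜 n)) :
    ιU (Matrix.single a a' e) * (lowerWord 𝕜 n w * diagWord 𝕜 n w₂ * upperWord 𝕜 n w₃) ∈
      triangularSpan 𝕜 n := by
  rcases lt_trichotomy a a' with h | rfl | h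
  · exact hup a a' h e w₂ w₃
  · exact diag_mul_word_mem a e w w₂ w₃
  · exact lower_mul_mem h e (word_mem _ _ _)

/-- Upper letters, base case: `ι(X) · (H-word · X-word) ∈ span`, by induction on the diagonal
word, using `[X, H] ∈ 𝔫` (an upper letter with the same indices). [folklore] -/
theorem upper_mul_diagWord_mem (w₂ : FreeMonoid (DiagLetter 𝕜 n)) :
    ∀ (j k : Fin n), j < k → ∀ (b : 𝕜) (w₃ : FreeMonoid (UpperLetter 𝕜 n)),
      ιU (Matrix.single j k b) * (lowerWord 𝕜 n 1 * diagWord 𝕜 n w₂ * upperWord 𝕜 n w₃) ∈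
        triangularSpan 𝕜 n := by
  induction w₂ using FreeMonoid.inductionOn' with
  | one =>
    intro j k hjk b w₃
    have : ιU (Matrix.single j k b) * (lowerWord 𝕜 n 1 * diagWord 𝕜 n 1 * upperWord 𝕜 n w₃) =
        lowerWord 𝕜 n 1 * diagWord 𝕜 n 1 *
          upperWord 𝕜 n (FreeMonoid.of (⟨⟨(j, k), hjk⟩, b⟩ : UpperLetter 𝕜 n) * w₃) := by
      simp only [map_one, one_mul, map_mul, upperWord_of]
    rw [this]; exact word_mem _ _ _
  | mul_of ℓ w ih =>
    intro j k hjk b w₃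
    obtain ⟨p, c⟩ := ℓ
    have hR : lowerWord 𝕜 n 1 * diagWord 𝕜 n (FreeMonoid.of ((p, c) : DiagLetter 𝕜 n) * w) *
        upperWord 𝕜 n w₃ =
        ιU (Matrix.single p p c) * (lowerWord 𝕜 n 1 * diagWord 𝕜 n w * upperWord 𝕜 n w₃) := by
      simp only [map_one, one_mul, map_mul, diagWord_of, mul_assoc]
    rw [hR, ι_mul_ι_mul]
    refine add_mem (diag_mul_mem p c (ih j k hjk b w₃)) ?_
    rw [single_lie_single, map_sub, sub_mul]
    refine sub_mem (single_ite_mul_mem fun h ↦ ?_) (single_ite_mul_mem fun h ↦ ?_)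
    · subst h; exact ih j k hjk _ w₃
    · subst h; exact ih p k hjk _ w₃

/-- Upper letters: `ι(X) · (standard monomial) ∈ span`, by induction on the lower word, using that
`[X, Y]` is a sum of at most two letters (of any of the three kinds). [folklore] -/
theorem upper_mul_word_mem (w₁ : FreeMonoid (LowerLetter 𝕜 n)) :
    ∀ (j k : Fin n), j < k → ∀ (b : 𝕜) (w₂ : FreeMonoid (DiagLetter 𝕜 n))
      (w₃ : FreeMonoid (UpperLetter 𝕜 n)),
      ιU (Matrix.single j k b) * (lowerWord 𝕜 n w₁ * diagWord 𝕜 n w₂ * upperWord 𝕜 n w₃) ∈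
        triangularSpan 𝕜 n := by
  induction w₁ using FreeMonoid.inductionOn' with
  | one => intro j k hjk b w₂ w₃; exact upper_mul_diagWord_mem w₂ j k hjk b w₃
  | mul_of ℓ w ih =>
    intro j k hjk b w₂ w₃
    obtain ⟨⟨⟨p, q⟩, hqp⟩, c⟩ := ℓ
    have hR : lowerWord 𝕜 n (FreeMonoid.of (⟨⟨(p, q), hqp⟩, c⟩ : LowerLetter 𝕜 n) * w) *
        diagWord 𝕜 n w₂ * upperWord 𝕜 n w₃ = ιU (Matrix.single p q c) *
        (lowerWord 𝕜 n w * diagWord 𝕜 n w₂ * upperWord 𝕜 n w₃) := by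
      simp only [map_mul, lowerWord_of, mul_assoc]
    rw [hR, ι_mul_ι_mul]
    refine add_mem (lower_mul_mem hqp c (ih j k hjk b w₂ w₃)) ?_
    rw [single_lie_single, map_sub, sub_mul]
    exact sub_mem (single_ite_mul_mem fun _ ↦ single_mul_word_mem_of_upper w ih _ _ _ _ _)
      (single_ite_mul_mem fun _ ↦ single_mul_word_mem_of_upper w ih _ _ _ _ _)

/-- Any matrix unit `ι(e E_{aa'})` preserves the span. [folklore] -/
theorem single_mul_mem (a a' : Fin n) (e : 𝕜) {u : UGL 𝕜 n} (hu : u ∈ triangularSpan 𝕜 n) :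
    ιU (Matrix.single a a' e) * u ∈ triangularSpan 𝕜 n := by
  refine mul_mem_span_of_forall (fun s hs ↦ ?_) hu
  obtain ⟨w₁, w₂, w₃, rfl⟩ := hs
  exact single_mul_word_mem_of_upper w₁ (upper_mul_word_mem w₁) a a' e w₂ w₃

/-- `ι(X)` preserves the span for every `X ∈ 𝔤𝔩ₙ(𝕜)`. [folklore] -/
theorem ι_mul_mem (X : Matrix (Fin n) (Fin n) 𝕜) {u : UGL 𝕜 n} (hu : u ∈ triangularSpan 𝕜 n) :
    ιU X * u ∈ triangularSpan 𝕜 n := by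
  rw [Matrix.matrix_eq_sum_single X, map_sum, Finset.sum_mul]
  refine Submodule.sum_mem _ fun a _ ↦ ?_
  rw [map_sum, Finset.sum_mul]
  exact Submodule.sum_mem _ fun a' _ ↦ single_mul_mem a a' _ hu

/-- A real subspace of `U(𝔤)` that is stable under left multiplication by `ι(𝔤)` is stable under
left multiplication by all of `U(𝔤)` (`U(𝔤)` is generated by `ι(𝔤)`). [folklore] -/
theorem mul_mem_of_ι_mul_mem {L : Type*} [LieRing L] [LieAlgebra ℝ L]
    (A : Submodule ℝ (UniversalEnvelopingAlgebra ℝ L))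
    (hA : ∀ (x : L), ∀ a ∈ A, UniversalEnvelopingAlgebra.ι ℝ x * a ∈ A)
    (u : UniversalEnvelopingAlgebra ℝ L) {a : UniversalEnvelopingAlgebra ℝ L} (ha : a ∈ A) :
    u * a ∈ A := by
  obtain ⟨t, rfl⟩ : ∃ t, UniversalEnvelopingAlgebra.mkAlgHom ℝ L t = u :=
    RingCon.mkₐ_surjective _ u
  induction t using TensorAlgebra.induction generalizing a with
  | algebraMap r =>
    rw [AlgHom.commutes, Algebra.algebraMap_eq_smul_one, smul_mul_assoc, one_mul]
    exact A.smul_mem r ha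
  | ι x => exact hA x a ha
  | mul t₁ t₂ h₁ h₂ => rw [map_mul, mul_assoc]; exact h₁ (h₂ ha)
  | add t₁ t₂ h₁ h₂ => rw [map_add, add_mul]; exact add_mem (h₁ ha) (h₂ ha)

/-- **Triangular spanning** (`U(𝔤) = U(𝔫⁻)U(𝔥)U(𝔫)`, spanning form): the standard monomials
`ι(Y₁)⋯ι(Y_a) ι(H₁)⋯ι(H_b) ι(X₁)⋯ι(X_c)` (lower, diagonal, upper letters) span the real universal
enveloping algebra of `𝔤𝔩ₙ(𝕜)`. Humphreys, GTM 9, §17.3 Corollary C (PBW basis; only the spanning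
half is proved here) and §23.3 (PBW bases "putting the `y_α` first, then the `hᵢ`, then the `x_α`");
Knapp, *Lie Groups Beyond an Introduction*, Ch. III (PBW) with §V.5.
[cite: Humphreys1972, §17.3 Corollary C and §23.3] -/
theorem span_triangularWords_eq_top : triangularSpan 𝕜 n = ⊤ := by
  refine eq_top_iff.mpr fun u _ ↦ ?_
  have h1 : (1 : UGL 𝕜 n) ∈ triangularSpan 𝕜 n := Submodule.subset_span one_mem_triangularWords
  simpa using mul_mem_of_ι_mul_mem (triangularSpan 𝕜 n) (fun x _ ha ↦ ι_mul_mem x ha) u h1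

/-- Unpacked form of `span_triangularWords_eq_top`: every element of `U(𝔤𝔩ₙ(𝕜))` is a finite real
linear combination `∑ᵢ cᵢ • (lowerWord w₁ᵢ * diagWord w₂ᵢ * upperWord w₃ᵢ)`.
Humphreys, §17.3 Corollary C and §23.3. [cite: Humphreys1972, §17.3 Corollary C and §23.3] -/
theorem exists_sum_triangularWords (u : UGL 𝕜 n) :
    ∃ (m : ℕ) (c : Fin m → ℝ) (w₁ : Fin m → FreeMonoid (LowerLetter 𝕜 n))
      (w₂ : Fin m → FreeMonoid (DiagLetter 𝕜 n)) (w₃ : Fin m → FreeMonoid (UpperLetter 𝕜 n)),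
      u = ∑ i, c i • (lowerWord 𝕜 n (w₁ i) * diagWord 𝕜 n (w₂ i) * upperWord 𝕜 n (w₃ i)) := by
  have hu : u ∈ triangularSpan 𝕜 n := by rw [span_triangularWords_eq_top]; trivial
  obtain ⟨m, c, g, hg⟩ := Submodule.mem_span_set'.mp hu
  choose w₁ w₂ w₃ hw using fun i ↦ (g i).2
  exact ⟨m, c, w₁, w₂, w₃, by rw [← hg]; simp_rw [← hw]⟩

end Literature.NumberTheory.Automorphic.HCSpan
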